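import Literature.AnabelianGeometry.EtaleTheta.MonoThetaEnv
import Mathlib.Tactic.Group

/-!
# [EtTh] §2 discharge: automorphisms of a model mono-theta environment act on `Π^tp_X`
# (the mechanism of Cor 2.18 (iii) "`Π•_X := Aut(Π•_Y) ×_{Out(Π•_Y)} Im(D_Π•) ≅ Π^tp_X`")

Mochizuki, *The Étale Theta Function and its Frobenioid-theoretic Manifestations* [EtTh],
Publ. RIMS 45 (2009), §2, Def 2.13 (i)–(ii) pp.47–48, Cor 2.18 (iii) p.61, Cor 2.19 (i) p.64
(locators `p.N` = PDF pages of the PRIMS text; bib key `MochizukiEtTh2009`).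
PROOF-ONLY companion of `MonoThetaEnv.lean` (seat abc-iut-L2-t2; nothing there is edited or
restated); discharge seat abc-iut-L2-d1, node `EtTh:Cor2.19(i)` (lane C2 of plan/LONG-CHAINS).

What is proved here, from the fields of `ThetaEnvData` alone (pure group theory / topology of the
cyclotomic envelope `Π^tp_Y[μ_N] = μ_N ⋊ Π^tp_Y`):

* `ThetaEnvData.conjX_mem_contMulAut` — the `Gal(Y/X)`-conjugations `conjX g` are automorphisms
  of the TOPOLOGICAL group `Π^tp_Y[μ_N]` (so every `g ∈ Π^tp_X` contributes a generator of `D_Y`);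
* `ThetaEnvData.exists_over_of_mk_mem_DY` — every representative of an element of
  `D_Y ⊆ Out(Π^tp_Y[μ_N])` lies over conjugation by some `g ∈ Π^tp_X` on the quotient `Π^tp_Y`
  (the Kummer part of `D_Y` acts trivially on `Π^tp_Y`, Def 2.13 (i), p.47);
* `ThetaEnvData.exists_continuousMulEquiv_PiX_of_iso` — **the lifting step of Cor 2.18 (iii) /
  Cor 2.19 (i)**: an automorphism `α` of the model mono-theta environment `M(η)` that preserves
  `Ker(Π^tp_Y[μ_N] ↠ Π^tp_Y)` induces, through `D_Y ↦ D_Y` and the temp-slimness of the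
  conjugation action of `Π^tp_X` on `Π^tp_Y` (the named fact `RigidData.Cor218_iii_PiX`, taken as
  the hypothesis `hslim`), an automorphism `γ` of the topological group `Π^tp_X` with
  `(α x)‾ = γ(x̄)` on `Π^tp_Y` ("we obtain a topological group `Π•_X` … any isomorphism
  `M ≅ M^•` induces compatible isomorphisms", p.61).

Nothing here refers to curves; no named facts are introduced (every declaration is proved).
HONEST FRAMING: no side is taken on [IUTchIII] Cor 3.12; typed ≠ discharged elsewhere.
-/

namespace Literature.AnabelianGeometry.EtaleTheta

universe u

namespace ThetaEnvData

variable {N : ℕ+} (T : ThetaEnvData.{u} N)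

/-! ## Continuity bookkeeping on `Π^tp_Y[μ_N] = μ_N ⋊ Π^tp_Y` -/

/-- The coordinate `x ↦ x.left ∈ μ_N` is continuous. [cite: MochizukiEtTh2009, Def 2.13(ii) p.47] -/
theorem continuous_left : Continuous fun x : T.env => x.left :=
  (continuous_fst.comp continuous_induced_dom :
    Continuous (Prod.fst ∘ fun x : T.env => (x.left, x.right)))

/-- The coordinate `x ↦ x.right ∈ Π^tp_Y` is continuous. [cite: MochizukiEtTh2009, Def 2.13(ii) p.47] -/
theorem continuous_right : Continuous fun x : T.env => x.right :=
  (continuous_snd.comp continuous_induced_dom :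
    Continuous (Prod.snd ∘ fun x : T.env => (x.left, x.right)))

/-- A map into `Π^tp_Y[μ_N]` is continuous as soon as both coordinates are.
[cite: MochizukiEtTh2009, Def 2.13(ii) p.47] -/
theorem continuous_env_mk {X : Type*} [TopologicalSpace X] {f : X → T.mu} {k : X → T.PiY}
    (hf : Continuous f) (hk : Continuous k) :
    Continuous fun x => (⟨f x, k x⟩ : T.env) :=
  continuous_induced_rng.2 (show Continuous fun x => (f x, k x) from hf.prodMk hk)

/-- The tautological section `Π^tp_Y → Π^tp_Y[μ_N]` is continuous.
[cite: MochizukiEtTh2009, Def 2.13(ii) p.47] -/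
theorem continuous_algSection : Continuous (CycEnvelope.algSection T.augY T.chi) :=
  T.continuous_env_mk continuous_const continuous_id

/-- The conjugation automorphism `conjX g` (`g ∈ Π^tp_X`) of `Π^tp_Y[μ_N]` is continuous.
[cite: MochizukiEtTh2009, Def 2.13(i) p.47] -/
theorem continuous_conjX (g : T.PiX) : Continuous (T.conjX g) := by
  change Continuous fun x : T.env => (⟨T.chi (T.aug g) x.left,
    ⟨g * (x.right : T.PiX) * g⁻¹, T.PiY_normal.conj_mem _ x.right.2 g⟩⟩ : T.env)
  refine T.continuous_env_mk (continuous_of_discreteTopology.comp T.continuous_left) ?_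
  exact ((continuous_const.mul (continuous_subtype_val.comp T.continuous_right)).mul
    continuous_const).subtype_mk _

/-- `(conjX g)⁻¹ = conjX g⁻¹`. [cite: MochizukiEtTh2009, Def 2.13(i) p.47] -/
theorem conjX_symm (g : T.PiX) : (T.conjX g).symm = T.conjX g⁻¹ := by
  apply MulEquiv.ext
  intro x
  apply (T.conjX g).injective
  rw [MulEquiv.apply_symm_apply]
  ext
  · simp [conjX, map_inv]
  · simp [conjX, mul_assoc]

/-- **The `Gal(Y/X)`-conjugations are automorphisms of the topological group `Π^tp_Y[μ_N]`.**
[cite: MochizukiEtTh2009, Def 2.13(i) p.47] -/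
theorem conjX_mem_contMulAut (g : T.PiX) : T.conjX g ∈ contMulAut T.env := by
  refine ⟨T.continuous_conjX g, ?_⟩
  change Continuous (T.conjX g).symm
  rw [T.conjX_symm]
  exact T.continuous_conjX g⁻¹

/-- `conjX` is multiplicative in `g`. [cite: MochizukiEtTh2009, Def 2.13(i) p.47] -/
theorem conjX_mul (g g' : T.PiX) : T.conjX (g * g') = T.conjX g * T.conjX g' := by
  apply MulEquiv.ext
  intro x
  rw [MulAut.mul_apply]
  ext
  · simp [conjX]
  · simp [conjX, mul_assoc]

/-- On `Π^tp_Y` itself, `conjX h` is inner: conjugation by `s^alg(h) = (1, h)`.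
[cite: MochizukiEtTh2009, Def 2.13(i) p.47] -/
theorem conjX_coe (h : T.PiY) :
    T.conjX (h : T.PiX) = MulAut.conj (CycEnvelope.algSection T.augY T.chi h) := by
  apply MulEquiv.ext
  intro x
  rw [MulAut.conj_apply]
  ext
  · simp [conjX]
  · simp [conjX, mul_assoc]

/-- `conjX g` lies over conjugation by `g` on the quotient `Π^tp_Y`.
[cite: MochizukiEtTh2009, Def 2.13(i) p.47] -/
theorem right_conjX (g : T.PiX) (x : T.env) :
    ((T.conjX g x).right : T.PiX) = g * (x.right : T.PiX) * g⁻¹ := rfl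

/-- [`[γ] ↦ [e ∘ γ ∘ e⁻¹]`] Transport of outer automorphisms, on representatives.
[cite: MochizukiEtTh2009, Def 2.13(ii) p.47] -/
theorem transport_mk {A B : Type*} [Group A] [Group B] [TopologicalSpace A] [TopologicalSpace B]
    (e : A ≃ₜ* B) (φ : contMulAut A) :
    TopOut.transport e (TopOut.mk A φ) = TopOut.mk B (conjContAut e φ) := rfl

/-- The transported automorphism, evaluated. [cite: MochizukiEtTh2009, Def 2.13(ii) p.47] -/
theorem conjContAut_apply {A B : Type*} [Group A] [Group B] [TopologicalSpace A]
    [TopologicalSpace B] (e : A ≃ₜ* B) (φ : contMulAut A) (b : B) :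
    ((conjContAut e φ : contMulAut B) : MulAut B) b = e ((φ : MulAut A) (e.symm b)) := rfl

/-! ## Elements of `D_Y` lie over `Π^tp_X`-conjugations of `Π^tp_Y` -/

/-- If `[φ] = [ψ]` in `Out(Π^tp_Y[μ_N])` and `ψ` lies over conjugation by some `g ∈ Π^tp_X` on
`Π^tp_Y`, then so does `φ` (inner automorphisms lie over `Π^tp_Y`-conjugations).
[cite: MochizukiEtTh2009, Def 2.13(i) p.47] -/
theorem exists_over_of_mk_eq {φ ψ : contMulAut T.env} (h : TopOut.mk _ φ = TopOut.mk _ ψ)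
    {g : T.PiX} (hψ : ∀ x : T.env, (((ψ : MulAut T.env) x).right : T.PiX) = g * x.right * g⁻¹) :
    ∃ g' : T.PiX, ∀ x : T.env, (((φ : MulAut T.env) x).right : T.PiX) = g' * x.right * g'⁻¹ := by
  obtain ⟨z, hz, hzeq⟩ := (QuotientGroup.mk'_eq_mk' _).mp h.symm
  obtain ⟨y, hy⟩ := MonoidHom.mem_range.mp (Subgroup.mem_subgroupOf.mp hz)
  refine ⟨g * (y.right : T.PiX), fun x => ?_⟩
  have : (φ : MulAut T.env) x = (ψ : MulAut T.env) (y * x * y⁻¹) := by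
    rw [← hzeq, Subgroup.coe_mul, MulAut.mul_apply, ← hy, MulAut.conj_apply]
  rw [this, hψ]
  simp only [SemidirectProduct.mul_right, SemidirectProduct.inv_right, Subgroup.coe_mul,
    Subgroup.coe_inv, mul_inv_rev, mul_assoc]

/-- **Every representative of an element of `D_Y` lies over conjugation by an element of `Π^tp_X`
on `Π^tp_Y`** (the Kummer generators act trivially on `Π^tp_Y`, the `Gal(Y/X)` generators by
`Π^tp_X`-conjugation; Def 2.13 (i)). [cite: MochizukiEtTh2009, Def 2.13(i) p.47] -/
theorem exists_over_of_mk_mem_DY (φ : contMulAut T.env) (hφ : TopOut.mk _ φ ∈ T.DY) :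
    ∃ g : T.PiX, ∀ x : T.env, (((φ : MulAut T.env) x).right : T.PiX) = g * x.right * g⁻¹ := by
  have key : ∀ d ∈ T.DY, ∀ φ : contMulAut T.env, TopOut.mk _ φ = d →
      ∃ g : T.PiX, ∀ x : T.env, (((φ : MulAut T.env) x).right : T.PiX) = g * x.right * g⁻¹ := by
    intro d hd
    refine Subgroup.closure_induction (p := fun d _ => ∀ φ : contMulAut T.env,
      TopOut.mk _ φ = d → ∃ g : T.PiX, ∀ x : T.env,
        (((φ : MulAut T.env) x).right : T.PiX) = g * x.right * g⁻¹) ?_ ?_ ?_ ?_ hd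
    · rintro d (⟨δ, hδ, hc, rfl⟩ | ⟨g, hc, rfl⟩) φ hφd
      · refine T.exists_over_of_mk_eq hφd (g := 1) fun x => ?_
        change ((CycEnvelope.shift hδ x).right : T.PiX) = _
        simp [CycEnvelope.shift]
      · exact T.exists_over_of_mk_eq hφd (g := g) fun x => T.right_conjX g x
    · intro φ hφ
      refine T.exists_over_of_mk_eq (ψ := 1) (by simpa using hφ) (g := 1) fun x => ?_
      simp
    · intro d₁ d₂ _ _ h₁ h₂ φ hφ
      obtain ⟨φ₁, rfl⟩ := QuotientGroup.mk'_surjective _ d₁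
      obtain ⟨g₁, hg₁⟩ := h₁ φ₁ rfl
      obtain ⟨g₂, hg₂⟩ := h₂ (φ₁⁻¹ * φ) (by rw [map_mul, map_inv, hφ, inv_mul_cancel_left])
      refine ⟨g₁ * g₂, fun x => ?_⟩
      have : (φ : MulAut T.env) x = (φ₁ : MulAut T.env) (((φ₁⁻¹ * φ : contMulAut T.env) :
          MulAut T.env) x) := by
        rw [Subgroup.coe_mul, Subgroup.coe_inv, MulAut.mul_apply, MulAut.apply_inv_self]
      rw [this, hg₁, hg₂]
      simp only [mul_inv_rev, mul_assoc]
    · intro d _ h φ hφ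
      obtain ⟨g, hg⟩ := h φ⁻¹ (by rw [map_inv, hφ, inv_inv])
      refine ⟨g⁻¹, fun x => ?_⟩
      have hx := hg ((φ : MulAut T.env) x)
      rw [Subgroup.coe_inv, MulAut.inv_apply_self] at hx
      rw [hx]
      group
  exact key _ hφ φ rfl

/-- `[conjX g] ∈ D_Y`. [cite: MochizukiEtTh2009, Def 2.13(i) p.47] -/
theorem mk_conjX_mem_DY (g : T.PiX) :
    TopOut.mk _ ⟨T.conjX g, T.conjX_mem_contMulAut g⟩ ∈ T.DY :=
  Subgroup.subset_closure (Set.mem_union_right _ ⟨g, T.conjX_mem_contMulAut g, rfl⟩)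

/-! ## Lifting an automorphism of a model mono-theta environment to `Π^tp_X` -/

section Lift

variable {T}

/-- If `e ∈ Aut(Π^tp_Y[μ_N])` preserves `Ker(Π^tp_Y[μ_N] ↠ Π^tp_Y)`, then `(e x)‾ ∈ Π^tp_Y` depends
only on `x̄`. [cite: MochizukiEtTh2009, Cor 2.18(iii) p.61] -/
theorem right_eq_of_right_eq (e : T.env ≃ₜ* T.env)
    (hker : ((CycEnvelope.proj T.augY T.chi).ker).map e.toMulEquiv.toMonoidHom =
      (CycEnvelope.proj T.augY T.chi).ker)
    {x y : T.env} (h : x.right = y.right) : (e x).right = (e y).right := by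
  have hm : x * y⁻¹ ∈ (CycEnvelope.proj T.augY T.chi).ker := by
    rw [MonoidHom.mem_ker, map_mul, map_inv]
    change x.right * y.right⁻¹ = 1
    rw [h, mul_inv_cancel]
  have hm' : e (x * y⁻¹) ∈ (CycEnvelope.proj T.augY T.chi).ker := by
    rw [← hker]; exact ⟨_, hm, rfl⟩
  rw [MonoidHom.mem_ker, map_mul, map_inv, map_mul, map_inv, mul_inv_eq_one] at hm'
  exact hm'

/-- The kernel hypothesis passes to `e⁻¹`. [cite: MochizukiEtTh2009, Cor 2.18(iii) p.61] -/
theorem map_ker_symm_of_map_ker (e : T.env ≃ₜ* T.env)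
    (hker : ((CycEnvelope.proj T.augY T.chi).ker).map e.toMulEquiv.toMonoidHom =
      (CycEnvelope.proj T.augY T.chi).ker) :
    ((CycEnvelope.proj T.augY T.chi).ker).map e.symm.toMulEquiv.toMonoidHom =
      (CycEnvelope.proj T.augY T.chi).ker := by
  conv_lhs => rw [← hker, Subgroup.map_map]
  have : e.symm.toMulEquiv.toMonoidHom.comp e.toMulEquiv.toMonoidHom = MonoidHom.id _ :=
    MonoidHom.ext fun x => e.symm_apply_apply x
  rw [this, Subgroup.map_id]

variable {η : T.PiYdd → T.mu} {hη : η ∈ T.thetaCocycles}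
  (α : (T.modelMono hη).Iso (T.modelMono hη))

/-- For every `g ∈ Π^tp_X` there is `g' ∈ Π^tp_X` with `(α(conjX g · z))‾ = g' · (α z)‾ · g'⁻¹`:
the image of `[conjX g] ∈ D_Y` under `D_Y ↦ D_Y` lies over `g'`.
[cite: MochizukiEtTh2009, Cor 2.18(iii) p.61] -/
theorem exists_conj_right_iso (g : T.PiX) :
    ∃ g' : T.PiX, ∀ z : T.env,
      ((α.e (T.conjX g z)).right : T.PiX) = g' * ((α.e z).right : T.PiX) * g'⁻¹ := by
  have hmem : TopOut.transport α.e (TopOut.mk _ ⟨T.conjX g, T.conjX_mem_contMulAut g⟩) ∈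
      T.DY := by
    have h := α.map_D
    change T.DY.map (TopOut.transport α.e) = T.DY at h
    rw [← h]
    exact ⟨_, T.mk_conjX_mem_DY g, rfl⟩
  rw [transport_mk] at hmem
  obtain ⟨g', hg'⟩ := T.exists_over_of_mk_mem_DY _ hmem
  refine ⟨g', fun z => ?_⟩
  have := hg' (α.e z)
  rw [conjContAut_apply] at this
  change ((α.e (T.conjX g (α.e.symm (α.e z)))).right : T.PiX) = _ at this
  rwa [ContinuousMulEquiv.symm_apply_apply] at this

/-- Conversely, for every `g' ∈ Π^tp_X` some `[φ] ∈ D_Y`, `φ` over `g`, maps to `[conjX g']`: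
`g' · x̄ · g'⁻¹ = (α(conjX g · α⁻¹(y x y⁻¹)))‾` for suitable `g ∈ Π^tp_X`, `y ∈ Π^tp_Y[μ_N]`.
[cite: MochizukiEtTh2009, Cor 2.18(iii) p.61] -/
theorem exists_conj_right_iso_symm
    (hker : ((CycEnvelope.proj T.augY T.chi).ker).map α.e.toMulEquiv.toMonoidHom =
      (CycEnvelope.proj T.augY T.chi).ker) (g' : T.PiX) :
    ∃ (g : T.PiX) (y : T.env), ∀ x : T.env,
      g' * (x.right : T.PiX) * g'⁻¹ =
        ((α.e (T.conjX g (α.e.symm (y * x * y⁻¹)))).right : T.PiX) := by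
  have hmem : TopOut.mk _ ⟨T.conjX g', T.conjX_mem_contMulAut g'⟩ ∈
      T.DY.map (TopOut.transport α.e) := by
    have h := α.map_D
    change T.DY.map (TopOut.transport α.e) = T.DY at h
    rw [h]
    exact T.mk_conjX_mem_DY g'
  obtain ⟨d, hd, hdeq⟩ := hmem
  obtain ⟨φ, rfl⟩ := QuotientGroup.mk'_surjective _ d
  obtain ⟨g, hg⟩ := T.exists_over_of_mk_mem_DY φ hd
  change TopOut.transport α.e (TopOut.mk _ φ) = _ at hdeq
  rw [transport_mk] at hdeq
  obtain ⟨z, hz, hzeq⟩ := (QuotientGroup.mk'_eq_mk' _).mp hdeq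
  obtain ⟨y, hy⟩ := MonoidHom.mem_range.mp (Subgroup.mem_subgroupOf.mp hz)
  refine ⟨g, y, fun x => ?_⟩
  rw [← T.right_conjX g' x]
  have h2 : T.conjX g' x = ((conjContAut α.e φ : contMulAut T.env) : MulAut T.env)
      ((z : MulAut T.env) x) := by
    have := congrArg (fun w : contMulAut T.env => (w : MulAut T.env) x) hzeq
    simpa only [Subgroup.coe_mul, MulAut.mul_apply] using this.symm
  rw [h2, conjContAut_apply, ← hy, MulAut.conj_apply]
  apply congrArg Subtype.val
  apply right_eq_of_right_eq α.e hker
  apply Subtype.ext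
  rw [hg, T.right_conjX]

/-- Uniqueness of the element of `Π^tp_X` inducing a given conjugation on `Π^tp_Y`, from the
temp-slimness hypothesis (the named fact `RigidData.Cor218_iii_PiX`).
[cite: MochizukiEtTh2009, Cor 2.18(iii) p.61] -/
theorem eq_of_conj_eq (hslim : ∀ x : T.PiX, (∀ h : T.PiY, x * h * x⁻¹ = h) → x = 1)
    {g₁ g₂ : T.PiX} (h : ∀ p : T.PiY, g₁ * (p : T.PiX) * g₁⁻¹ = g₂ * (p : T.PiX) * g₂⁻¹) :
    g₁ = g₂ := by
  have h21 : g₂⁻¹ * g₁ = 1 := hslim (g₂⁻¹ * g₁) fun p => by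
    have hp := h p
    calc g₂⁻¹ * g₁ * ↑p * (g₂⁻¹ * g₁)⁻¹ = g₂⁻¹ * (g₁ * ↑p * g₁⁻¹) * g₂ := by group
      _ = g₂⁻¹ * (g₂ * ↑p * g₂⁻¹) * g₂ := by rw [hp]
      _ = ↑p := by group
  exact (inv_mul_eq_one.mp h21).symm

/-- **Lifting automorphisms of a model mono-theta environment to `Π^tp_X`** (the mechanism of
Cor 2.18 (iii), "`Π•_X := Aut(Π•_Y) ×_{Out(Π•_Y)} Im(D_Π•) ≅ Π^tp_X`", and of the proof of
Cor 2.19 (i), "any isomorphism `M ≅ M^•` induces compatible isomorphisms between the various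
subquotients"): if `α ∈ Aut(M(η))` preserves `Ker(Π^tp_Y[μ_N] ↠ Π^tp_Y)` and the conjugation
action of `Π^tp_X` on `Π^tp_Y` is faithful (temp-slimness, `RigidData.Cor218_iii_PiX`), then there
is an automorphism `γ` of the topological group `Π^tp_X` with `(α x)‾ = γ(x̄)` for all
`x ∈ Π^tp_Y[μ_N]`. [cite: MochizukiEtTh2009, Cor 2.18(iii) p.61] -/
theorem exists_continuousMulEquiv_PiX_of_iso
    (hker : ((CycEnvelope.proj T.augY T.chi).ker).map α.e.toMulEquiv.toMonoidHom =
      (CycEnvelope.proj T.augY T.chi).ker)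
    (hslim : ∀ x : T.PiX, (∀ h : T.PiY, x * h * x⁻¹ = h) → x = 1) :
    ∃ γ : T.PiX ≃ₜ* T.PiX, ∀ x : T.env, ((α.e x).right : T.PiX) = γ (x.right : T.PiX) := by
  have key : ∀ g : T.PiX, ∃ g' : T.PiX, ∀ z : T.env,
      ((α.e (T.conjX g z)).right : T.PiX) = g' * ((α.e z).right : T.PiX) * g'⁻¹ :=
    fun g => exists_conj_right_iso α g
  choose γf hγf using key
  -- `z ↦ (α z)‾` is onto `Π^tp_Y`
  have hAsurj : ∀ p : T.PiY, ∃ z : T.env, (α.e z).right = p := fun p =>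
    ⟨α.e.symm (CycEnvelope.algSection T.augY T.chi p), by
      rw [ContinuousMulEquiv.apply_symm_apply]; rfl⟩
  -- uniqueness of `g'`
  have huniq : ∀ {g g₁ g₂ : T.PiX},
      (∀ z : T.env, ((α.e (T.conjX g z)).right : T.PiX) = g₁ * ((α.e z).right : T.PiX) * g₁⁻¹) →
      (∀ z : T.env, ((α.e (T.conjX g z)).right : T.PiX) = g₂ * ((α.e z).right : T.PiX) * g₂⁻¹) →
      g₁ = g₂ := by
    intro g g₁ g₂ h₁ h₂
    refine eq_of_conj_eq hslim fun p => ?_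
    obtain ⟨z, hz⟩ := hAsurj p
    rw [← hz, ← h₁ z, ← h₂ z]
  -- multiplicativity
  have hmul : ∀ g₁ g₂, γf (g₁ * g₂) = γf g₁ * γf g₂ := by
    intro g₁ g₂
    refine huniq (hγf (g₁ * g₂)) fun z => ?_
    rw [T.conjX_mul, MulAut.mul_apply, hγf g₁, hγf g₂]
    simp only [mul_assoc, mul_inv_rev]
  -- on `Π^tp_Y`
  have hPiY : ∀ p : T.PiY, γf (p : T.PiX) =
      ((α.e (CycEnvelope.algSection T.augY T.chi p)).right : T.PiX) := by
    intro p
    refine huniq (hγf p) fun z => ?_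
    rw [T.conjX_coe, MulAut.conj_apply, map_mul, map_mul, map_inv]
    simp only [SemidirectProduct.mul_right, SemidirectProduct.inv_right, Subgroup.coe_mul,
      Subgroup.coe_inv]
  -- extension property
  have hext : ∀ x : T.env, γf (x.right : T.PiX) = ((α.e x).right : T.PiX) := by
    intro x
    rw [hPiY]
    exact congrArg Subtype.val (right_eq_of_right_eq α.e hker rfl)
  -- injectivity
  have hker' := map_ker_symm_of_map_ker α.e hker
  have hinj : Function.Injective γf := by
    intro g₁ g₂ h
    refine eq_of_conj_eq hslim fun p => ?_
    let z : T.env := CycEnvelope.algSection T.augY T.chi p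
    have h12 : (α.e (T.conjX g₁ z)).right = (α.e (T.conjX g₂ z)).right := by
      apply Subtype.ext; rw [hγf g₁, hγf g₂, h]
    have h12' := right_eq_of_right_eq α.e.symm hker' h12
    rw [ContinuousMulEquiv.symm_apply_apply, ContinuousMulEquiv.symm_apply_apply] at h12'
    have := congrArg Subtype.val h12'
    rwa [T.right_conjX, T.right_conjX] at this
  -- surjectivity
  have hsurj : Function.Surjective γf := by
    intro g'
    obtain ⟨g, y, hgy⟩ := exists_conj_right_iso_symm α hker g'
    let h₁ : T.PiY := (α.e.symm (CycEnvelope.algSection T.augY T.chi y.right)).right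
    have hh₁ : γf (h₁ : T.PiX) = (y.right : T.PiX) := by
      rw [hext, ContinuousMulEquiv.apply_symm_apply]
      rfl
    refine ⟨g * h₁, ?_⟩
    refine eq_of_conj_eq hslim fun p => ?_
    rw [hmul, hh₁]
    have := hgy (CycEnvelope.algSection T.augY T.chi p)
    rw [hγf g, ContinuousMulEquiv.apply_symm_apply] at this
    change g' * (p : T.PiX) * g'⁻¹ = _ at this
    rw [this]
    simp only [SemidirectProduct.mul_right, SemidirectProduct.inv_right, Subgroup.coe_mul,
      Subgroup.coe_inv, SemidirectProduct.right_inr, mul_assoc, mul_inv_rev]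
  -- the group automorphism
  let γ₀ : T.PiX ≃* T.PiX := MulEquiv.ofBijective (MonoidHom.mk' γf hmul) ⟨hinj, hsurj⟩
  have hγ₀ : ∀ g, γ₀ g = γf g := fun g => rfl
  have hemb := T.PiY_open.isOpenEmbedding_subtypeVal
  have h1 : ((1 : T.PiY) : T.PiX) = 1 := rfl
  -- continuity of `γ₀` : it agrees with the continuous `p ↦ (α s^alg(p))‾` on the open `Π^tp_Y`
  have hcont : Continuous γ₀ := by
    apply continuous_of_continuousAt_one
    rw [← h1, ← hemb.continuousAt_iff]
    exact ((continuous_subtype_val.comp (T.continuous_right.comp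
      (α.e.continuous.comp T.continuous_algSection))).congr fun p => (hPiY p).symm).continuousAt
  -- continuity of `γ₀⁻¹` : it agrees with `p ↦ (α⁻¹ s^alg(p))‾` on `Π^tp_Y`
  have hsymm_apply : ∀ p : T.PiY, γ₀.symm (p : T.PiX) =
      ((α.e.symm (CycEnvelope.algSection T.augY T.chi p)).right : T.PiX) := by
    intro p
    apply γ₀.injective
    rw [MulEquiv.apply_symm_apply, hγ₀, hext, ContinuousMulEquiv.apply_symm_apply]
    rfl
  have hcont' : Continuous γ₀.symm := by
    apply continuous_of_continuousAt_one
    rw [← h1, ← hemb.continuousAt_iff]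
    exact ((continuous_subtype_val.comp (T.continuous_right.comp
      (α.e.symm.continuous.comp T.continuous_algSection))).congr
      fun p => (hsymm_apply p).symm).continuousAt
  exact ⟨ContinuousMulEquiv.mk γ₀ hcont hcont', fun x => (hext x).symm⟩

end Lift

end ThetaEnvData

end Literature.AnabelianGeometry.EtaleTheta
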